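import Mathlib
import HarnessLib

/-!
# The angle-doubling map of the unit disc (Lambert coordinates of a reflected direction)

For a unit vector `a ∈ ℝ³`, Lambert's orthographic coordinates `p = coords a ω ∈ ℝ²` of a unit vector
`ω` in the hemisphere `⟪a, ω⟫ > 0` (`Literature.Analysis.FluidPDE.DicedHardSphereDynamics`,
`LambertCosineLaw`) turn the reflected direction `σ = a - 2⟪a, ω⟫ ω` — the direction of the
post-collisional relative velocity of a hard-sphere collision with impact direction `ω` and incoming
relative velocity along `a` — into `double p = -2√(1 - ‖p‖²) p` (polar angle `θ ↦ π - 2θ`).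

This file is the planar (`ℝ²`, Mathlib-only) half of the conversion between the `ω`- and the
`σ`-parametrisation of hard-sphere collisions (`SphereReflectionPushforward`):

* `Lambert.double`, `Lambert.doubleDeriv`, `hasFDerivAt_double`, `det_doubleDeriv`
  (`det = 4(1 - 2‖p‖²)`, a `2 × 2` determinant in the standard basis),
  `sqrt_one_sub_norm_sq_double` (`√(1 - ‖double p‖²) = |1 - 2‖p‖²|`);
* `injOn_double_outer/inner`, `image_double_outer/inner`: `double` maps each of the outer annulus
  `{1/2 < ‖p‖², ‖p‖ < 1}` and the inner punctured disc `{p ≠ 0, ‖p‖² < 1/2}` bijectively onto the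
  punctured unit disc;
* `lintegral_comp_double_outer/inner`: the change of variables
  `∫_A G(double p) dp = ∫_{‖q‖<1} G(q) / (4√(1 - ‖q‖²)) dq` on each piece (Mathlib's
  `lintegral_image_eq_lintegral_abs_det_fderiv_mul`; the Jacobian `4|1 - 2‖p‖²|` equals
  `4√(1 - ‖double p‖²)`).
-/

noncomputable section

open scoped ENNReal InnerProductSpace
open MeasureTheory Set Metric Real

namespace Literature.Analysis.FluidPDE

local notation "E²" => EuclideanSpace ℝ (Fin 2)

namespace Lambert

/-- The **angle-doubling map of the unit disc** in Lambert coordinates: `double p = -2√(1-‖p‖²) p`.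
If `p = coords a ω` is the Lambert coordinate of a unit vector `ω` with `⟪a, ω⟫ > 0` (polar angle
`θ < π/2` from `a`), then `double p` is the Lambert coordinate of the reflected direction
`σ = a - 2⟪a, ω⟫ ω` (polar angle `π - 2θ`): `|double p| = sin 2θ = 2 sin θ cos θ`. It maps each of the
annuli `{1/√2 < ‖p‖ < 1}` and `{0 < ‖p‖ < 1/√2}` diffeomorphically onto the punctured disc, with
Jacobian `|det D double (p)| = 4 |1 - 2‖p‖²| = 4 √(1 - ‖double p‖²)`. [folklore] -/
def double (p : E²) : E² := (-2 * √(1 - ‖p‖ ^ 2)) • p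

/-- The derivative of `double` at a point of the open unit disc. [folklore] -/
def doubleDeriv (p : E²) : E² →L[ℝ] E² :=
  (-2 * √(1 - ‖p‖ ^ 2)) • ContinuousLinearMap.id ℝ E² +
    ((1 / √(1 - ‖p‖ ^ 2)) • ((2 : ℝ) • innerSL ℝ p)).smulRight p

/-- Unfolding of `doubleDeriv`. [folklore] -/
theorem doubleDeriv_apply (p h : E²) :
    doubleDeriv p h = (-2 * √(1 - ‖p‖ ^ 2)) • h + ((1 / √(1 - ‖p‖ ^ 2)) * (2 * ⟪p, h⟫_ℝ)) • p := by
  simp [doubleDeriv]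

/-- `double` is differentiable on the open unit disc with derivative `doubleDeriv`. [folklore] -/
theorem hasFDerivAt_double {p : E²} (hp : ‖p‖ < 1) : HasFDerivAt double (doubleDeriv p) p := by
  have h1 : 0 < 1 - ‖p‖ ^ 2 := by nlinarith [norm_nonneg p]
  have hn : HasFDerivAt (fun x : E² => ‖x‖ ^ 2) (2 • innerSL ℝ p) p :=
    (hasStrictFDerivAt_norm_sq p).hasFDerivAt
  have hs : HasDerivAt (fun t : ℝ => √(1 - t)) (-1 / (2 * √(1 - ‖p‖ ^ 2))) (‖p‖ ^ 2) := by
    simpa using ((hasDerivAt_id (‖p‖ ^ 2)).const_sub 1).sqrt (by simpa using h1.ne')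
  have hg : HasDerivAt (fun t : ℝ => -2 * √(1 - t)) (1 / √(1 - ‖p‖ ^ 2)) (‖p‖ ^ 2) := by
    have h := hs.const_mul (-2 : ℝ)
    have heq : (-2 : ℝ) * (-1 / (2 * √(1 - ‖p‖ ^ 2))) = 1 / √(1 - ‖p‖ ^ 2) := by ring
    rw [heq] at h
    exact h
  have hc : HasFDerivAt (fun x : E² => -2 * √(1 - ‖x‖ ^ 2))
      ((1 / √(1 - ‖p‖ ^ 2)) • (2 • innerSL ℝ p)) p :=
    HasDerivAt.comp_hasFDerivAt (h₂ := fun t : ℝ => -2 * √(1 - t)) (f := fun x : E² => ‖x‖ ^ 2)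
      p hg hn
  have h := hc.smul (hasFDerivAt_id p)
  refine h.congr_fderiv ?_
  ext h' i
  simp [doubleDeriv, two_smul]

/-- `‖double p‖² = 4 ‖p‖² (1 - ‖p‖²)` on the closed unit disc. [folklore] -/
theorem norm_sq_double {p : E²} (hp : ‖p‖ ≤ 1) : ‖double p‖ ^ 2 = 4 * ‖p‖ ^ 2 * (1 - ‖p‖ ^ 2) := by
  have h1 : 0 ≤ 1 - ‖p‖ ^ 2 := by nlinarith [norm_nonneg p]
  rw [double, norm_smul, mul_pow, Real.norm_eq_abs, sq_abs, mul_pow, Real.sq_sqrt h1]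
  ring

/-- `√(1 - ‖double p‖²) = |1 - 2‖p‖²|` on the closed unit disc. [folklore] -/
theorem sqrt_one_sub_norm_sq_double {p : E²} (hp : ‖p‖ ≤ 1) :
    √(1 - ‖double p‖ ^ 2) = |1 - 2 * ‖p‖ ^ 2| := by
  rw [norm_sq_double hp, show 1 - 4 * ‖p‖ ^ 2 * (1 - ‖p‖ ^ 2) = (1 - 2 * ‖p‖ ^ 2) ^ 2 by ring,
    Real.sqrt_sq_eq_abs]

/-- **The Jacobian determinant of `double`**: `det D double (p) = 4 (1 - 2‖p‖²)` (`‖p‖ < 1`),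
computed in the standard basis of `ℝ²` (matrix `c I + (2/s) p pᵀ`, `c = -2s`, `s = √(1-‖p‖²)`).
[folklore] -/
theorem det_doubleDeriv {p : E²} (hp : ‖p‖ < 1) : (doubleDeriv p).det = 4 * (1 - 2 * ‖p‖ ^ 2) := by
  have h1 : 0 < 1 - ‖p‖ ^ 2 := by nlinarith [norm_nonneg p]
  set s := √(1 - ‖p‖ ^ 2) with hs
  have hs0 : s ≠ 0 := (Real.sqrt_pos.2 h1).ne'
  have hs2 : s ^ 2 = 1 - ‖p‖ ^ 2 := Real.sq_sqrt h1.le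
  set b := (EuclideanSpace.basisFun (Fin 2) ℝ).toBasis with hb
  have hdet : (doubleDeriv p).det =
      (LinearMap.toMatrix b b (doubleDeriv p : E² →ₗ[ℝ] E²)).det :=
    (LinearMap.det_toMatrix b _).symm
  have hentry : ∀ i j : Fin 2, LinearMap.toMatrix b b (doubleDeriv p : E² →ₗ[ℝ] E²) i j =
      doubleDeriv p (EuclideanSpace.single j 1) i := by
    intro i j
    rw [LinearMap.toMatrix_apply, hb, OrthonormalBasis.coe_toBasis, EuclideanSpace.basisFun_apply,
      OrthonormalBasis.coe_toBasis_repr_apply, EuclideanSpace.basisFun_repr,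
      ContinuousLinearMap.coe_coe]
  rw [hdet, Matrix.det_fin_two, hentry, hentry, hentry, hentry]
  have hn : ‖p‖ ^ 2 = p 0 ^ 2 + p 1 ^ 2 := by
    rw [EuclideanSpace.norm_sq_eq, Fin.sum_univ_two, Real.norm_eq_abs, Real.norm_eq_abs, sq_abs,
      sq_abs]
  simp only [doubleDeriv_apply, ← hs, EuclideanSpace.inner_single_right, PiLp.add_apply,
    PiLp.smul_apply, PiLp.single_apply, smul_eq_mul, Fin.isValue, if_true,
    one_ne_zero, zero_ne_one, if_false, conj_trivial, mul_one, mul_zero, one_mul]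
  field_simp
  rw [hn] at hs2 ⊢
  linear_combination (4 * s ^ 2) * hs2

/-! ### The two annuli and the change of variables -/

/-- `‖double p‖² < 1` off the circle `‖p‖² = 1/2` (closed unit disc). [folklore] -/
theorem norm_sq_double_lt_one {p : E²} (hp : ‖p‖ ≤ 1) (h : ‖p‖ ^ 2 ≠ 1 / 2) : ‖double p‖ ^ 2 < 1 := by
  rw [norm_sq_double hp]
  have : 0 < (1 - 2 * ‖p‖ ^ 2) ^ 2 := by
    have h' : 1 - 2 * ‖p‖ ^ 2 ≠ 0 := fun h0 => h (by linarith)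
    positivity
  nlinarith

/-- `double p ≠ 0` for `p ≠ 0` in the open unit disc. [folklore] -/
theorem norm_sq_double_pos {p : E²} (hp : ‖p‖ < 1) (h0 : p ≠ 0) : 0 < ‖double p‖ ^ 2 := by
  rw [norm_sq_double hp.le]
  have h1 : 0 < 1 - ‖p‖ ^ 2 := by nlinarith [norm_nonneg p]
  have h2 : 0 < ‖p‖ := norm_pos_iff.2 h0
  positivity

/-- Injectivity of `double` on a set of the disc where `‖p‖²` stays on one side of `1/2`:
if `double p = double p'` then `(‖p‖² - ‖p'‖²)(1 - ‖p‖² - ‖p'‖²) = 0`. [folklore] -/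
theorem double_eq_double {p p' : E²} (hp : ‖p‖ < 1) (hp' : ‖p'‖ < 1) (h : double p = double p')
    (hside : 1 - ‖p‖ ^ 2 - ‖p'‖ ^ 2 ≠ 0) : p = p' := by
  have hn : ‖double p‖ ^ 2 = ‖double p'‖ ^ 2 := by rw [h]
  rw [norm_sq_double hp.le, norm_sq_double hp'.le] at hn
  have ht : ‖p‖ ^ 2 = ‖p'‖ ^ 2 := by
    have : (‖p‖ ^ 2 - ‖p'‖ ^ 2) * (1 - ‖p‖ ^ 2 - ‖p'‖ ^ 2) = 0 := by nlinarith
    rcases mul_eq_zero.1 this with h1 | h1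
    · linarith
    · exact absurd h1 hside
  have hc : (-2 * √(1 - ‖p‖ ^ 2)) ≠ 0 := by
    have h1 : 0 < 1 - ‖p‖ ^ 2 := by nlinarith [norm_nonneg p]
    have := Real.sqrt_pos.2 h1
    nlinarith
  have h2 : (-2 * √(1 - ‖p‖ ^ 2)) • p = (-2 * √(1 - ‖p‖ ^ 2)) • p' := by
    have h' := h
    rw [double, double, ← ht] at h'
    exact h'
  exact smul_right_injective E² hc h2

/-- The outer annulus `{1/2 < ‖p‖² , ‖p‖ < 1}`: `double` is injective there. [folklore] -/
theorem injOn_double_outer : InjOn double {p : E² | 1 / 2 < ‖p‖ ^ 2 ∧ ‖p‖ < 1} := by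
  intro p hp p' hp' h
  exact double_eq_double hp.2 hp'.2 h (by nlinarith [hp.1, hp'.1])

/-- The inner punctured disc `{p ≠ 0, ‖p‖² < 1/2}`: `double` is injective there. [folklore] -/
theorem injOn_double_inner : InjOn double {p : E² | p ≠ 0 ∧ ‖p‖ ^ 2 < 1 / 2} := by
  intro p hp p' hp' h
  have h1 : ‖p‖ < 1 := by nlinarith [norm_nonneg p, hp.2]
  have h2 : ‖p'‖ < 1 := by nlinarith [norm_nonneg p', hp'.2]
  exact double_eq_double h1 h2 h (by nlinarith [hp.2, hp'.2])

/-- A preimage under `double`: for `0 < ‖q‖ < 1` and `0 < ρ < 1` with `4ρ(1-ρ) = ‖q‖²`, the point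
`p = -(√ρ/‖q‖) q` has `‖p‖² = ρ` and `double p = q`. [folklore] -/
theorem double_preimage_point {q : E²} (hq0 : q ≠ 0) {ρ : ℝ} (hρ0 : 0 < ρ) (hρ1 : ρ < 1)
    (hρ : 4 * ρ * (1 - ρ) = ‖q‖ ^ 2) :
    ‖(-(√ρ / ‖q‖)) • q‖ ^ 2 = ρ ∧ double ((-(√ρ / ‖q‖)) • q) = q := by
  have hq : 0 < ‖q‖ := norm_pos_iff.2 hq0
  have hnorm : ‖(-(√ρ / ‖q‖)) • q‖ ^ 2 = ρ := by
    rw [norm_smul, Real.norm_eq_abs, abs_neg, abs_div, abs_of_nonneg (Real.sqrt_nonneg _),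
      abs_of_pos hq, div_mul_cancel₀ _ hq.ne', Real.sq_sqrt hρ0.le]
  refine ⟨hnorm, ?_⟩
  rw [double, hnorm, smul_smul]
  have key : -2 * √(1 - ρ) * -(√ρ / ‖q‖) = 1 := by
    rw [show -2 * √(1 - ρ) * -(√ρ / ‖q‖) = 2 * (√(1 - ρ) * √ρ) / ‖q‖ by ring,
      ← Real.sqrt_mul (by linarith), div_eq_one_iff_eq hq.ne']
    have h4 : (2 * √((1 - ρ) * ρ)) ^ 2 = ‖q‖ ^ 2 := by
      rw [mul_pow, Real.sq_sqrt (by nlinarith)]; linarith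
    have h5 : 0 ≤ 2 * √((1 - ρ) * ρ) := by positivity
    nlinarith [sq_nonneg (2 * √((1 - ρ) * ρ) - ‖q‖), sq_nonneg (2 * √((1 - ρ) * ρ) + ‖q‖)]
  rw [key, one_smul]

/-- `double` maps the outer annulus onto the punctured unit disc. [folklore] -/
theorem image_double_outer :
    double '' {p : E² | 1 / 2 < ‖p‖ ^ 2 ∧ ‖p‖ < 1} = ball (0 : E²) 1 \ {0} := by
  ext q
  simp only [mem_image, mem_setOf_eq, Set.mem_sdiff, mem_ball, dist_zero_right, mem_singleton_iff]
  constructor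
  · rintro ⟨p, ⟨hp1, hp2⟩, rfl⟩
    have hlt := norm_sq_double_lt_one hp2.le (by linarith)
    have hpos := norm_sq_double_pos hp2 (by
      intro h0; rw [h0, norm_zero] at hp1; norm_num at hp1)
    refine ⟨by nlinarith [norm_nonneg (double p)], fun h0 => ?_⟩
    rw [h0, norm_zero] at hpos
    norm_num at hpos
  · rintro ⟨hq1, hq0⟩
    have hq : 0 < ‖q‖ := norm_pos_iff.2 hq0
    set σ := √(1 - ‖q‖ ^ 2) with hσ
    have hσ0 : 0 < σ := Real.sqrt_pos.2 (by nlinarith)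
    have hσ1 : σ < 1 := by
      rw [hσ, Real.sqrt_lt' one_pos]; nlinarith
    have hσ2 : σ ^ 2 = 1 - ‖q‖ ^ 2 := Real.sq_sqrt (by nlinarith)
    set ρ := (1 + σ) / 2 with hρ
    have h := double_preimage_point hq0 (ρ := ρ) (by linarith) (by linarith)
      (by rw [hρ]; nlinarith [hσ2])
    refine ⟨(-(√ρ / ‖q‖)) • q, ⟨?_, ?_⟩, h.2⟩
    · rw [h.1, hρ]; linarith
    · have : ‖(-(√ρ / ‖q‖)) • q‖ ^ 2 < 1 := by rw [h.1, hρ]; linarith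
      nlinarith [norm_nonneg ((-(√ρ / ‖q‖)) • q)]

/-- `double` maps the inner punctured disc onto the punctured unit disc. [folklore] -/
theorem image_double_inner :
    double '' {p : E² | p ≠ 0 ∧ ‖p‖ ^ 2 < 1 / 2} = ball (0 : E²) 1 \ {0} := by
  ext q
  simp only [mem_image, mem_setOf_eq, Set.mem_sdiff, mem_ball, dist_zero_right, mem_singleton_iff]
  constructor
  · rintro ⟨p, ⟨hp1, hp2⟩, rfl⟩
    have hp3 : ‖p‖ < 1 := by nlinarith [norm_nonneg p]
    have hlt := norm_sq_double_lt_one hp3.le (by linarith)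
    have hpos := norm_sq_double_pos hp3 hp1
    refine ⟨by nlinarith [norm_nonneg (double p)], fun h0 => ?_⟩
    rw [h0, norm_zero] at hpos
    norm_num at hpos
  · rintro ⟨hq1, hq0⟩
    have hq : 0 < ‖q‖ := norm_pos_iff.2 hq0
    set σ := √(1 - ‖q‖ ^ 2) with hσ
    have hσ0 : 0 < σ := Real.sqrt_pos.2 (by nlinarith)
    have hσ1 : σ < 1 := by
      rw [hσ, Real.sqrt_lt' one_pos]; nlinarith
    have hσ2 : σ ^ 2 = 1 - ‖q‖ ^ 2 := Real.sq_sqrt (by nlinarith)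
    set ρ := (1 - σ) / 2 with hρ
    have h := double_preimage_point hq0 (ρ := ρ) (by linarith) (by linarith)
      (by rw [hρ]; nlinarith [hσ2])
    refine ⟨(-(√ρ / ‖q‖)) • q, ⟨?_, ?_⟩, h.2⟩
    · intro h0
      have := h.1
      rw [h0, norm_zero] at this
      have : (0 : ℝ) < ρ := by linarith
      nlinarith
    · rw [h.1, hρ]; linarith

/-- The punctured disc has the same Lebesgue integrals as the disc. [folklore] -/
theorem setLIntegral_ball_diff_zero (f : E² → ℝ≥0∞) :
    ∫⁻ q in ball (0 : E²) 1 \ {0}, f q = ∫⁻ q in ball (0 : E²) 1, f q :=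
  setLIntegral_congr (sdiff_ae_eq_self.2 (measure_mono_null inter_subset_right (measure_singleton 0)))

/-- The common core of the change of variables for `double` on a region `A` of the open unit disc,
off the circle `‖p‖² = 1/2`, on which it is injective with image the punctured disc:
`∫_A G(double p) dp = ∫_{‖q‖<1} G(q) / (4√(1-‖q‖²)) dq`. [folklore] -/
theorem lintegral_comp_double_of_image {A : Set E²} (hA : MeasurableSet A)
    (hAsub : A ⊆ {p : E² | ‖p‖ < 1 ∧ ‖p‖ ^ 2 ≠ 1 / 2}) (hinj : InjOn double A)
    (himage : double '' A = ball (0 : E²) 1 \ {0}) (G : E² → ℝ≥0∞) :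
    ∫⁻ p in A, G (double p) =
      ∫⁻ q in ball (0 : E²) 1, G q / ENNReal.ofReal (4 * √(1 - ‖q‖ ^ 2)) := by
  have hderiv : ∀ p ∈ A, HasFDerivWithinAt double (doubleDeriv p) A p := fun p hp =>
    (hasFDerivAt_double (hAsub hp).1).hasFDerivWithinAt
  have hcv := lintegral_image_eq_lintegral_abs_det_fderiv_mul volume hA hderiv hinj
    (fun q => G q / ENNReal.ofReal (4 * √(1 - ‖q‖ ^ 2)))
  rw [himage, setLIntegral_ball_diff_zero] at hcv
  rw [hcv]
  refine setLIntegral_congr_fun hA fun p hp => ?_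
  have hp1 := (hAsub hp).1
  have hp2 := (hAsub hp).2
  rw [det_doubleDeriv hp1, sqrt_one_sub_norm_sq_double hp1.le, abs_mul, abs_of_pos four_pos]
  have hne : ENNReal.ofReal (4 * |1 - 2 * ‖p‖ ^ 2|) ≠ 0 := by
    have : 1 - 2 * ‖p‖ ^ 2 ≠ 0 := fun h0 => hp2 (by linarith)
    have : 0 < 4 * |1 - 2 * ‖p‖ ^ 2| := by positivity
    exact (ENNReal.ofReal_pos.2 this).ne'
  exact (ENNReal.mul_div_cancel hne ENNReal.ofReal_ne_top).symm

/-- **Change of variables for `double` on the outer annulus** `{1/2 < ‖p‖², ‖p‖ < 1}`. [folklore] -/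
theorem lintegral_comp_double_outer (G : E² → ℝ≥0∞) :
    ∫⁻ p in {p : E² | 1 / 2 < ‖p‖ ^ 2 ∧ ‖p‖ < 1}, G (double p) =
      ∫⁻ q in ball (0 : E²) 1, G q / ENNReal.ofReal (4 * √(1 - ‖q‖ ^ 2)) := by
  refine lintegral_comp_double_of_image ?_ (fun p hp => ⟨hp.2, by linarith [hp.1]⟩)
    injOn_double_outer image_double_outer G
  exact ((isOpen_lt continuous_const (continuous_norm.pow 2)).inter
    (isOpen_lt continuous_norm continuous_const)).measurableSet

/-- **Change of variables for `double` on the inner disc** `{p ≠ 0, ‖p‖² < 1/2}`. [folklore] -/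
theorem lintegral_comp_double_inner (G : E² → ℝ≥0∞) :
    ∫⁻ p in {p : E² | p ≠ 0 ∧ ‖p‖ ^ 2 < 1 / 2}, G (double p) =
      ∫⁻ q in ball (0 : E²) 1, G q / ENNReal.ofReal (4 * √(1 - ‖q‖ ^ 2)) := by
  refine lintegral_comp_double_of_image ?_
    (fun p hp => ⟨by nlinarith [norm_nonneg p, hp.2], by linarith [hp.2]⟩)
    injOn_double_inner image_double_inner G
  exact (isOpen_compl_singleton.inter
    (isOpen_lt (continuous_norm.pow 2) continuous_const)).measurableSet


end Lambert

end Literature.Analysis.FluidPDE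

end
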